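import Summits.CriticalPhenomena.PercolationContinuityZ3.Theorems.PercNearOneGluingNoHeavyLowerTailSahiE3ExchangeCross
import Mathlib.Tactic.Linarith
import Mathlib.Tactic.Ring
import Mathlib.Tactic.Positivity
import HarnessLib
import HarnessLib.Audit

/-!
# `NoHeavyLowerTail` (crux stmt-CriticalPhenomena-4575), Sahi programme P4: the 2×2 exchange lemma in the PURE class — the `ψ`-form, Lemma A, and the sign cases

Support file (cell `prim-l12`, seat P4, generation 27; `--supports stmt-CriticalPhenomena-4575`).  No named facts, no sorries;
standard axioms; def-free.

Context (HOME prim-l12-p4/FROM-prim-l12-p4-gen27-*.md; predecessors `…SahiE3ExchangeCross` (crossing-free case),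
`…SahiE3ExchangeNested*` (one-side-nested classes), `…SahiE3ExchangeChain` (chain reduction)).  On a Harris block `(B, w, V)`
(`w ≥ 0` of mass `1`, slot `V`, `v = w(V)`, `a(X) = w(X∩V)`) the PURE (anti-nested) class of the exchange lemma is the
configuration `P = K ⊇ L = O`, `P' = L' ⊇ K' = O'`; there both bracket shapes coincide and the exchange expression is
  `Φ(R) = a(KL') + a(LK') − k·a(K') − l'·a(L) + R(KK'V) + R(LL'V) − need(K,L') − need(L,K') + (1−v)·[Cov(K,L') + (k−l)(l'−k')]`,
`need(X,Y) = x·a(Y) + y·a(X) − v·x·y`.  With the `V`-restricted covariance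
  `ψ(X,Y) := a(X∩Y) − x·a(Y) − y·a(X) + v·x·y = E[(1_X − x)(1_Y − y)·1_V]`
(an inner product on `L²(1_V·w)`; `need(X,Y) = a(X∩Y) − ψ(X,Y)`) and
  `R₀ := k'·κ(K) + l·κ(L') + (1−v)·[Cov(K,L') + (k−l)(l'−k')]`, `κ(X) = a(X) − v·x`,
the two packings of generation 26 evaluate to
  same-footprint `(K,K'),(L,L')`:      `Φ ≥ same0 = ψ(K,L') + ψ(L,K') + R₀`,
  chain `dom(KK'∪LL') + (L,K')`:      `Φ ≥ dm0   = ψ(K,L') + ψ(K,K') + ψ(L,L') + R₀`.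
This file proves **Lemma A**: `ψ(K,L') + R₀ ≥ 0` for all `L ⊆ K`, `K' ⊆ L'` from four Harris products
(`psi_add_R_nonneg`; the expression is bilinear in `(l,k') ∈ [0,k]×[0,l']` and its four corners are Harris slacks), and deduces
the exchange lemma in the pure class in the two SIGN CASES `ψ(L,K') ≥ 0` (same-footprint packing, `exchange_pure_of_psi_cross_nonneg`)
and `ψ(K,K') ≥ 0 ∧ ψ(L,L') ≥ 0` (chain packing, `exchange_pure_of_psi_same_nonneg`), plus the NESTED-SUPPLY case `K∩K'∩V ⊆ L`
(generation 26's theorem T1, `exchange_pure_of_nestedSupply`).  NOT claimed: the remaining sign case (`ψ(L,K') < 0` and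
`ψ(K,K') < 0` or `ψ(L,L') < 0`), where generation 27 showed that the two-member menu `{same0, dm0}` ("conjecture P" of generation 26)
FAILS (exact product-measure witness on Bool⁴, HOME memo) while the best-single-pair-per-footprint bound (2-CHAIN) holds numerically.
-/

namespace Summit.CriticalPhenomena.PercolationContinuityZ3.Theorems.SahiE3ExchangePure

open Finset SahiE3DimerPacking SahiE3ExchangeCross
open scoped BigOperators

variable {B : Type*} [DecidableEq B]

omit [DecidableEq B] in
/-- A sum of a nonnegative weight is nonnegative. [folklore] -/
theorem sum_nonneg' (w : B → ℝ) (hw : ∀ b, 0 ≤ w b) (X : Finset B) : 0 ≤ ∑ b ∈ X, w b :=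
  Finset.sum_nonneg fun b _ => hw b

/-- **Lemma A (pure class).**  For `w ≥ 0` of total mass `1`, `L ⊆ K`, `K' ⊆ L'` and the Harris products `Har(K;L'_V) ≥ 0`,
`Har(L';K_V) ≥ 0`, `κ(K∩L') ≥ 0`, `Cov(K,L') ≥ 0`:
`ψ(K,L') + k'·κ(K) + l·κ(L') + (1−v)·[Cov(K,L') + (k−l)(l'−k')] ≥ 0`.
Proof: the expression equals `A − k'·c(K) − l·c(L') + (1−v)·l·k'` with `A = ψ(K,L') + (1−v)·w(KL')`, `c(X) = w(X∖V)`; it is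
affine in `l ∈ [0,k]` and in `k' ∈ [0,l']`, and its four corner values are `Har(L';K_V) + (1−v)Cov(K,L')`, `Har(K;L'_V) + (1−v)Cov(K,L')`,
`κ(KL') + Cov(K,L')` and `A ≥ 0`. [this work] -/
theorem psi_add_R_nonneg [Fintype B] (w : B → ℝ) (hw : ∀ b, 0 ≤ w b) (hw1 : ∑ b, w b = 1)
    (V K L K' L' : Finset B) (hLK : L ⊆ K) (hK'L' : K' ⊆ L')
    (hHar₁ : (∑ b ∈ K, w b) * (∑ b ∈ L' ∩ V, w b) ≤ ∑ b ∈ (K ∩ L') ∩ V, w b)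
    (hHar₂ : (∑ b ∈ L', w b) * (∑ b ∈ K ∩ V, w b) ≤ ∑ b ∈ (K ∩ L') ∩ V, w b)
    (hHar₃ : (∑ b ∈ V, w b) * (∑ b ∈ K ∩ L', w b) ≤ ∑ b ∈ (K ∩ L') ∩ V, w b)
    (hHar₄ : (∑ b ∈ K, w b) * (∑ b ∈ L', w b) ≤ ∑ b ∈ K ∩ L', w b) :
    0 ≤ (∑ b ∈ (K ∩ L') ∩ V, w b) - (∑ b ∈ K, w b) * (∑ b ∈ L' ∩ V, w b)
          - (∑ b ∈ L', w b) * (∑ b ∈ K ∩ V, w b) + (∑ b ∈ V, w b) * (∑ b ∈ K, w b) * (∑ b ∈ L', w b)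
        + (∑ b ∈ K', w b) * ((∑ b ∈ K ∩ V, w b) - (∑ b ∈ V, w b) * (∑ b ∈ K, w b))
        + (∑ b ∈ L, w b) * ((∑ b ∈ L' ∩ V, w b) - (∑ b ∈ V, w b) * (∑ b ∈ L', w b))
        + (1 - ∑ b ∈ V, w b) * (((∑ b ∈ K ∩ L', w b) - (∑ b ∈ K, w b) * (∑ b ∈ L', w b))
            + ((∑ b ∈ K, w b) - ∑ b ∈ L, w b) * ((∑ b ∈ L', w b) - ∑ b ∈ K', w b)) := by
  set v := ∑ b ∈ V, w b with hv
  set k := ∑ b ∈ K, w b with hk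
  set l := ∑ b ∈ L, w b with hl
  set k' := ∑ b ∈ K', w b with hk'
  set l' := ∑ b ∈ L', w b with hl'
  set aK := ∑ b ∈ K ∩ V, w b with haK
  set aL' := ∑ b ∈ L' ∩ V, w b with haL'
  set aKL' := ∑ b ∈ (K ∩ L') ∩ V, w b with haKL'
  set mKL' := ∑ b ∈ K ∩ L', w b with hmKL'
  have hv1 : v ≤ 1 := by rw [hv, ← hw1]; exact sum_le_sum_of_subset' w hw (Finset.subset_univ V)
  have hv0 : 0 ≤ v := sum_nonneg' w hw V
  have hl0 : 0 ≤ l := sum_nonneg' w hw L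
  have hk'0 : 0 ≤ k' := sum_nonneg' w hw K'
  have hlk : l ≤ k := sum_le_sum_of_subset' w hw hLK
  have hk'l' : k' ≤ l' := sum_le_sum_of_subset' w hw hK'L'
  have haKk : aK ≤ k := sum_le_sum_of_subset' w hw Finset.inter_subset_left
  have haL'l' : aL' ≤ l' := sum_le_sum_of_subset' w hw Finset.inter_subset_left
  have haKL'm : aKL' ≤ mKL' := sum_le_sum_of_subset' w hw Finset.inter_subset_left
  have haK0 : 0 ≤ aK := sum_nonneg' w hw (K ∩ V)
  have haL'0 : 0 ≤ aL' := sum_nonneg' w hw (L' ∩ V)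
  have hk0 : 0 ≤ k := le_trans hl0 hlk
  have hl'0 : 0 ≤ l' := le_trans hk'0 hk'l'
  -- the three nontrivial corners (k,0), (0,l'), (k,l') and the corner (0,0)
  have cK0 : 0 ≤ aKL' - l' * aK + (1 - v) * (mKL' - k * l') := by nlinarith
  have c0L : 0 ≤ aKL' - k * aL' + (1 - v) * (mKL' - k * l') := by nlinarith
  have cKL : 0 ≤ (aKL' - v * mKL') + (mKL' - k * l') := by nlinarith
  have c00 : 0 ≤ aKL' - k * aL' - l' * aK + v * k * l' + (1 - v) * mKL' := by
    have e1 : 0 ≤ (1 - v) * (mKL' - aKL') := mul_nonneg (by linarith) (by linarith)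
    have e2 : 0 ≤ (1 - v) * (aKL' - k * aL') := mul_nonneg (by linarith) (by linarith)
    have e3 : 0 ≤ v * (k * (l' - aL')) := mul_nonneg hv0 (mul_nonneg hk0 (by linarith))
    nlinarith
  -- case analysis on the two slopes
  rcases le_or_gt 0 ((1 - v) * l - (k - aK)) with hσ₁ | hσ₁
  · -- slope in k' is ≥ 0: drop k' to 0, then l to k
    have e1 : 0 ≤ k' * ((1 - v) * l - (k - aK)) := mul_nonneg hk'0 hσ₁
    have e2 : 0 ≤ (k - l) * (l' - aL') := mul_nonneg (by linarith) (by linarith)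
    nlinarith
  · -- slope in k' is < 0: raise k' to l'
    have e1 : 0 ≤ (l' - k') * ((k - aK) - (1 - v) * l) := mul_nonneg (by linarith) (by linarith)
    rcases le_or_gt 0 ((1 - v) * l' - (l' - aL')) with hσ₂ | hσ₂
    · have e2 : 0 ≤ l * ((1 - v) * l' - (l' - aL')) := mul_nonneg hl0 hσ₂
      nlinarith
    · have e2 : 0 ≤ (k - l) * ((l' - aL') - (1 - v) * l') := mul_nonneg (by linarith) (by linarith)
      nlinarith

/-- **Chain/meet bookkeeping in the pure class.**  For `L ⊆ K`, `K' ⊆ L'` and any `f`: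
`f((KK' ∪ LL')∩V) + f(LK'∩V) = f(KK'V) + f(LL'V)` (pointwise `1_Σ + 1_Δ = 1_{S₁} + 1_{S₂}` with `Δ = L∩K'`). [folklore] -/
theorem sum_sigma_add_sum_delta (f : B → ℝ) (V K L K' L' : Finset B) (hLK : L ⊆ K) (hK'L' : K' ⊆ L') :
    ∑ b ∈ (K ∩ K' ∪ L ∩ L') ∩ V, f b + ∑ b ∈ (L ∩ K') ∩ V, f b
      = ∑ b ∈ (K ∩ K') ∩ V, f b + ∑ b ∈ (L ∩ L') ∩ V, f b := by
  simp only [sum_inter_eq_sum_ite, ← Finset.sum_add_distrib]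
  refine Finset.sum_congr rfl fun b _ => ?_
  simp only [Finset.mem_inter, Finset.mem_union]
  by_cases hk : b ∈ K <;> by_cases hl : b ∈ L <;> by_cases hk' : b ∈ K' <;> by_cases hl' : b ∈ L' <;>
    simp [hk, hl, hk', hl'] <;> first | exact absurd (hLK hl) hk | exact absurd (hK'L' hk') hl'

/-- **Pure class, sign case `ψ(L,K') ≥ 0`: the same-footprint packing certifies the exchange lemma.**
`B` finite, `w ≥ 0` of mass `1`, slot `V`, `L ⊆ K`, `K' ⊆ L'`, a weight `R` satisfying the pair inequality at the two
same-index pairs `(K,K')`, `(L,L')`, the four Harris products of Lemma A, and `ψ(L,K') ≥ 0`.  Then the pure-class exchange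
expression `Φ(R)` (module docstring; equal for both bracket shapes) is `≥ 0`:
`Φ ≥ same0 = [ψ(K,L') + R₀] + ψ(L,K') ≥ 0`. [this work] -/
theorem exchange_pure_of_psi_cross_nonneg [Fintype B] (w R : B → ℝ) (hw : ∀ b, 0 ≤ w b) (hw1 : ∑ b, w b = 1)
    (V K L K' L' : Finset B) (hLK : L ⊆ K) (hK'L' : K' ⊆ L')
    (hpairK : (∑ b ∈ K, w b) * (∑ b ∈ K' ∩ V, w b) + (∑ b ∈ K', w b) * (∑ b ∈ K ∩ V, w b)
        - (∑ b ∈ V, w b) * (∑ b ∈ K, w b) * (∑ b ∈ K', w b) ≤ ∑ b ∈ (K ∩ K') ∩ V, R b)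
    (hpairL : (∑ b ∈ L, w b) * (∑ b ∈ L' ∩ V, w b) + (∑ b ∈ L', w b) * (∑ b ∈ L ∩ V, w b)
        - (∑ b ∈ V, w b) * (∑ b ∈ L, w b) * (∑ b ∈ L', w b) ≤ ∑ b ∈ (L ∩ L') ∩ V, R b)
    (hHar₁ : (∑ b ∈ K, w b) * (∑ b ∈ L' ∩ V, w b) ≤ ∑ b ∈ (K ∩ L') ∩ V, w b)
    (hHar₂ : (∑ b ∈ L', w b) * (∑ b ∈ K ∩ V, w b) ≤ ∑ b ∈ (K ∩ L') ∩ V, w b)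
    (hHar₃ : (∑ b ∈ V, w b) * (∑ b ∈ K ∩ L', w b) ≤ ∑ b ∈ (K ∩ L') ∩ V, w b)
    (hHar₄ : (∑ b ∈ K, w b) * (∑ b ∈ L', w b) ≤ ∑ b ∈ K ∩ L', w b)
    (hψ : (∑ b ∈ L, w b) * (∑ b ∈ K' ∩ V, w b) + (∑ b ∈ K', w b) * (∑ b ∈ L ∩ V, w b)
        - (∑ b ∈ V, w b) * (∑ b ∈ L, w b) * (∑ b ∈ K', w b) ≤ ∑ b ∈ (L ∩ K') ∩ V, w b) :
    0 ≤ (∑ b ∈ (K ∩ L') ∩ V, w b) + (∑ b ∈ (L ∩ K') ∩ V, w b)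
        - (∑ b ∈ K, w b) * (∑ b ∈ K' ∩ V, w b) - (∑ b ∈ L', w b) * (∑ b ∈ L ∩ V, w b)
        + (∑ b ∈ (K ∩ K') ∩ V, R b) + (∑ b ∈ (L ∩ L') ∩ V, R b)
        - ((∑ b ∈ K, w b) * (∑ b ∈ L' ∩ V, w b) + (∑ b ∈ L', w b) * (∑ b ∈ K ∩ V, w b)
            - (∑ b ∈ V, w b) * (∑ b ∈ K, w b) * (∑ b ∈ L', w b))
        - ((∑ b ∈ L, w b) * (∑ b ∈ K' ∩ V, w b) + (∑ b ∈ K', w b) * (∑ b ∈ L ∩ V, w b)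
            - (∑ b ∈ V, w b) * (∑ b ∈ L, w b) * (∑ b ∈ K', w b))
        + (1 - ∑ b ∈ V, w b) * (((∑ b ∈ K ∩ L', w b) - (∑ b ∈ K, w b) * (∑ b ∈ L', w b))
            + ((∑ b ∈ K, w b) - ∑ b ∈ L, w b) * ((∑ b ∈ L', w b) - ∑ b ∈ K', w b)) := by
  have hA := psi_add_R_nonneg w hw hw1 V K L K' L' hLK hK'L' hHar₁ hHar₂ hHar₃ hHar₄
  nlinarith [hA, hψ, hpairK, hpairL]

/-- **Pure class, sign case `ψ(K,K') ≥ 0 ∧ ψ(L,L') ≥ 0`: the chain packing `dom(KK'∪LL') + (L,K')` certifies the exchange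
lemma.**  Same data; `R ≥ 0` on `V` satisfying the domination inequality on the union footprint `(KK' ∪ LL')∩V`
(`= need(KK'∪LL', B)`) and the pair inequality at `(L,K')`; then `Φ ≥ dm0 = [ψ(K,L') + R₀] + ψ(K,K') + ψ(L,L') ≥ 0`. [this work] -/
theorem exchange_pure_of_psi_same_nonneg [Fintype B] (w R : B → ℝ) (hw : ∀ b, 0 ≤ w b) (hw1 : ∑ b, w b = 1)
    (V K L K' L' : Finset B) (hLK : L ⊆ K) (hK'L' : K' ⊆ L')
    (hdom : ∑ b ∈ (K ∩ K' ∪ L ∩ L') ∩ V, w b ≤ ∑ b ∈ (K ∩ K' ∪ L ∩ L') ∩ V, R b)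
    (hpairLK' : (∑ b ∈ L, w b) * (∑ b ∈ K' ∩ V, w b) + (∑ b ∈ K', w b) * (∑ b ∈ L ∩ V, w b)
        - (∑ b ∈ V, w b) * (∑ b ∈ L, w b) * (∑ b ∈ K', w b) ≤ ∑ b ∈ (L ∩ K') ∩ V, R b)
    (hHar₁ : (∑ b ∈ K, w b) * (∑ b ∈ L' ∩ V, w b) ≤ ∑ b ∈ (K ∩ L') ∩ V, w b)
    (hHar₂ : (∑ b ∈ L', w b) * (∑ b ∈ K ∩ V, w b) ≤ ∑ b ∈ (K ∩ L') ∩ V, w b)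
    (hHar₃ : (∑ b ∈ V, w b) * (∑ b ∈ K ∩ L', w b) ≤ ∑ b ∈ (K ∩ L') ∩ V, w b)
    (hHar₄ : (∑ b ∈ K, w b) * (∑ b ∈ L', w b) ≤ ∑ b ∈ K ∩ L', w b)
    (hψ₁ : (∑ b ∈ K, w b) * (∑ b ∈ K' ∩ V, w b) + (∑ b ∈ K', w b) * (∑ b ∈ K ∩ V, w b)
        - (∑ b ∈ V, w b) * (∑ b ∈ K, w b) * (∑ b ∈ K', w b) ≤ ∑ b ∈ (K ∩ K') ∩ V, w b)
    (hψ₂ : (∑ b ∈ L, w b) * (∑ b ∈ L' ∩ V, w b) + (∑ b ∈ L', w b) * (∑ b ∈ L ∩ V, w b)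
        - (∑ b ∈ V, w b) * (∑ b ∈ L, w b) * (∑ b ∈ L', w b) ≤ ∑ b ∈ (L ∩ L') ∩ V, w b) :
    0 ≤ (∑ b ∈ (K ∩ L') ∩ V, w b) + (∑ b ∈ (L ∩ K') ∩ V, w b)
        - (∑ b ∈ K, w b) * (∑ b ∈ K' ∩ V, w b) - (∑ b ∈ L', w b) * (∑ b ∈ L ∩ V, w b)
        + (∑ b ∈ (K ∩ K') ∩ V, R b) + (∑ b ∈ (L ∩ L') ∩ V, R b)
        - ((∑ b ∈ K, w b) * (∑ b ∈ L' ∩ V, w b) + (∑ b ∈ L', w b) * (∑ b ∈ K ∩ V, w b)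
            - (∑ b ∈ V, w b) * (∑ b ∈ K, w b) * (∑ b ∈ L', w b))
        - ((∑ b ∈ L, w b) * (∑ b ∈ K' ∩ V, w b) + (∑ b ∈ K', w b) * (∑ b ∈ L ∩ V, w b)
            - (∑ b ∈ V, w b) * (∑ b ∈ L, w b) * (∑ b ∈ K', w b))
        + (1 - ∑ b ∈ V, w b) * (((∑ b ∈ K ∩ L', w b) - (∑ b ∈ K, w b) * (∑ b ∈ L', w b))
            + ((∑ b ∈ K, w b) - ∑ b ∈ L, w b) * ((∑ b ∈ L', w b) - ∑ b ∈ K', w b)) := by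
  have hA := psi_add_R_nonneg w hw hw1 V K L K' L' hLK hK'L' hHar₁ hHar₂ hHar₃ hHar₄
  have hRid := sum_sigma_add_sum_delta R V K L K' L' hLK hK'L'
  have hwid := sum_sigma_add_sum_delta w V K L K' L' hLK hK'L'
  nlinarith [hA, hψ₁, hψ₂, hdom, hpairLK', hRid, hwid]

/-- **Pure class, nested supplies (generation 26's theorem T1): `K∩K'∩V ⊆ L` ⇒ the same-footprint packing certifies the
exchange lemma.**  Here `same0 = Har(K;K'_V) + Har(L';K_V) + (1−v)·Cov(K,L') + k'·(a(K) − a(L)) + (k−l)·w((L'∖K')∖V) ≥ 0`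
termwise; hypotheses: the pair inequalities at `(K,K')`, `(L,L')` and the Harris products `Har(K;K'_V)`, `Har(L';K_V)`,
`Cov(K,L') ≥ 0`. [this work] -/
theorem exchange_pure_of_nestedSupply [Fintype B] (w R : B → ℝ) (hw : ∀ b, 0 ≤ w b) (hw1 : ∑ b, w b = 1)
    (V K L K' L' : Finset B) (hLK : L ⊆ K) (hK'L' : K' ⊆ L') (hnest : (K ∩ K') ∩ V ⊆ L)
    (hpairK : (∑ b ∈ K, w b) * (∑ b ∈ K' ∩ V, w b) + (∑ b ∈ K', w b) * (∑ b ∈ K ∩ V, w b)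
        - (∑ b ∈ V, w b) * (∑ b ∈ K, w b) * (∑ b ∈ K', w b) ≤ ∑ b ∈ (K ∩ K') ∩ V, R b)
    (hpairL : (∑ b ∈ L, w b) * (∑ b ∈ L' ∩ V, w b) + (∑ b ∈ L', w b) * (∑ b ∈ L ∩ V, w b)
        - (∑ b ∈ V, w b) * (∑ b ∈ L, w b) * (∑ b ∈ L', w b) ≤ ∑ b ∈ (L ∩ L') ∩ V, R b)
    (hHarKK' : (∑ b ∈ K, w b) * (∑ b ∈ K' ∩ V, w b) ≤ ∑ b ∈ (K ∩ K') ∩ V, w b)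
    (hHarL'K : (∑ b ∈ L', w b) * (∑ b ∈ K ∩ V, w b) ≤ ∑ b ∈ (K ∩ L') ∩ V, w b)
    (hHar₄ : (∑ b ∈ K, w b) * (∑ b ∈ L', w b) ≤ ∑ b ∈ K ∩ L', w b) :
    0 ≤ (∑ b ∈ (K ∩ L') ∩ V, w b) + (∑ b ∈ (L ∩ K') ∩ V, w b)
        - (∑ b ∈ K, w b) * (∑ b ∈ K' ∩ V, w b) - (∑ b ∈ L', w b) * (∑ b ∈ L ∩ V, w b)
        + (∑ b ∈ (K ∩ K') ∩ V, R b) + (∑ b ∈ (L ∩ L') ∩ V, R b)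
        - ((∑ b ∈ K, w b) * (∑ b ∈ L' ∩ V, w b) + (∑ b ∈ L', w b) * (∑ b ∈ K ∩ V, w b)
            - (∑ b ∈ V, w b) * (∑ b ∈ K, w b) * (∑ b ∈ L', w b))
        - ((∑ b ∈ L, w b) * (∑ b ∈ K' ∩ V, w b) + (∑ b ∈ K', w b) * (∑ b ∈ L ∩ V, w b)
            - (∑ b ∈ V, w b) * (∑ b ∈ L, w b) * (∑ b ∈ K', w b))
        + (1 - ∑ b ∈ V, w b) * (((∑ b ∈ K ∩ L', w b) - (∑ b ∈ K, w b) * (∑ b ∈ L', w b))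
            + ((∑ b ∈ K, w b) - ∑ b ∈ L, w b) * ((∑ b ∈ L', w b) - ∑ b ∈ K', w b)) := by
  -- nested supplies: the traces of K∩K' and L∩K' on V coincide
  have hset : (K ∩ K') ∩ V = (L ∩ K') ∩ V := by
    ext b
    simp only [Finset.mem_inter]
    constructor
    · rintro ⟨⟨hk, hk'⟩, hb⟩
      exact ⟨⟨hnest (Finset.mem_inter.2 ⟨Finset.mem_inter.2 ⟨hk, hk'⟩, hb⟩), hk'⟩, hb⟩
    · rintro ⟨⟨hl, hk'⟩, hb⟩
      exact ⟨⟨hLK hl, hk'⟩, hb⟩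
  have hξ : ∑ b ∈ (K ∩ K') ∩ V, w b = ∑ b ∈ (L ∩ K') ∩ V, w b := by rw [hset]
  have hv1 : ∑ b ∈ V, w b ≤ 1 := by rw [← hw1]; exact sum_le_sum_of_subset' w hw (Finset.subset_univ V)
  have hk'0 : 0 ≤ ∑ b ∈ K', w b := sum_nonneg' w hw K'
  have hlk : ∑ b ∈ L, w b ≤ ∑ b ∈ K, w b := sum_le_sum_of_subset' w hw hLK
  have haLK : ∑ b ∈ L ∩ V, w b ≤ ∑ b ∈ K ∩ V, w b :=
    sum_le_sum_of_subset' w hw (Finset.inter_subset_inter hLK le_rfl)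
  -- the annulus (L'∖K')∖V has nonnegative mass: (l' − k') − (aL' − aK') ≥ 0
  have hann : (∑ b ∈ L' ∩ V, w b) - (∑ b ∈ K' ∩ V, w b) ≤ (∑ b ∈ L', w b) - ∑ b ∈ K', w b := by
    have h1 : ∑ b ∈ L', w b = ∑ b ∈ L' ∩ V, w b + ∑ b ∈ L' \ V, w b := by
      rw [← Finset.sum_inter_add_sum_sdiff L' V]
    have h2 : ∑ b ∈ K', w b = ∑ b ∈ K' ∩ V, w b + ∑ b ∈ K' \ V, w b := by
      rw [← Finset.sum_inter_add_sum_sdiff K' V]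
    have h3 : ∑ b ∈ K' \ V, w b ≤ ∑ b ∈ L' \ V, w b :=
      sum_le_sum_of_subset' w hw (Finset.sdiff_subset_sdiff hK'L' le_rfl)
    linarith
  have e1 : 0 ≤ (1 - ∑ b ∈ V, w b) * ((∑ b ∈ K ∩ L', w b) - (∑ b ∈ K, w b) * (∑ b ∈ L', w b)) :=
    mul_nonneg (by linarith) (by linarith)
  have e2 : 0 ≤ (∑ b ∈ K', w b) * ((∑ b ∈ K ∩ V, w b) - ∑ b ∈ L ∩ V, w b) := mul_nonneg hk'0 (by linarith)
  have e3 : 0 ≤ ((∑ b ∈ K, w b) - ∑ b ∈ L, w b)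
      * (((∑ b ∈ L', w b) - ∑ b ∈ K', w b) - ((∑ b ∈ L' ∩ V, w b) - ∑ b ∈ K' ∩ V, w b)) :=
    mul_nonneg (by linarith) (by linarith)
  nlinarith [hξ, hpairK, hpairL, hHarKK', hHarL'K, e1, e2, e3]

end Summit.CriticalPhenomena.PercolationContinuityZ3.Theorems.SahiE3ExchangePure
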